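/-
Copyright (c) 2026 the pub-hodgecm-mathlib formalisation cell (harness21).  Prover seat hodgecm-mathlib-K2E1-p08 (g5), Track B ∕ K2-LIT, h413 =
`stmt-HodgeConjecture-24833`, campaign «EIS-RANK-ONE» rung R4 «EIS-R4-growth», road (A), file (A3) part 2∕3; DEAL BY NAME of the dealer K2E1-plan (g3) 2026-09-04T05:32:09Z
([D3]; spec of record K2E4-p11 (g3) 05:27:07Z §2 «multiplicity growth»).
-/
import Summits.HodgeConjecture.HodgeConjecture.Theorems.K2E1RationalPointsNearBorel         -- ★ p857629 (A1): `G(F) ∩ (g•C)(g•C)⁻¹ ⊆ B(F)♯ ∩ {x | x b = b d, d ∈ K(CC⁻¹)K⁻¹}` for `H(g)² > A` (brings ★ (G) smear, ★ (G0))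
import Summits.HodgeConjecture.HodgeConjecture.Theorems.K2E1BorelLatticeCount                -- ★ p857677 (A2): `#(B(F)♯ ∩ {x | x(ωa) = (ωa)d, d ∈ D}) ≤ M·H(ωa)²` on `Ω·A(t)` (brings ★ `exists_ray_of_adelicVal_mem_siegelCone`)
import Summits.HodgeConjecture.HodgeConjecture.Theorems.K2E1HeightFunctionU3                 -- ★ p857223 (K2E1-p08 g4): `H(1) = 1`, `H(a(r)) = r^{[E:ℚ]}`
import Literature.NumberTheory.Automorphic.MahlerCriterionPrelims                             -- ★ `Mahler.exists_isCompact_posRealDiagonal_box` (the low part of the cone is compact)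
import HarnessLib

/-!
# K2·E1 — `K2E1SiegelSetMultiplicityU3` (rung R4 «moderate growth», road (A), file (A3) part 2∕3): ON THE SIEGEL SET `𝔖 = Ω·A(t)·K` OF `U(J₃)` THE MULTIPLICITY OF
# GODEMENT'S COUNT GROWS LIKE `H²` — `#(G(F) ∩ (g•C)(g•C)⁻¹) ≤ M₁ · H(g)²` for every `g ∈ 𝔖`; the height floor and the compact low part of `𝔖`

Track B ∕ K2-LIT, crux h413 = `stmt-HodgeConjecture-24833`, route of record `HCCMUnconditional`; cell `hodgecm-mathlib`, squad K2, ENGINE E1, campaign EIS-RANK-ONE rung R4,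
road (A) «Godement's count» (dealer K2E1-plan (g3) 05:32:09Z [D3]; spec K2E4-p11 (g3) 05:27:07Z; census K2E1-p08 (g4) 05:08:07Z, K2E4-p14 (g5) 05:13:14Z).  Prover seat
`hodgecm-mathlib-K2E1-p08` (g5).  THEOREMS ONLY (no `def`, no `instance`, no notation, no named-fact hypothesis, no `sorry`); lane `--kind proof --supports stmt-HodgeConjecture-24833
--as helper` (count-neutral, closes no socket).

THE SIEGEL SET.  `𝔖 = Ω·A(t)·K` with `Ω ⊆ B(𝔸_F)` compact, `K` compact, `A(t) = adelicVal⁻¹(siegelCone 3 E t)` the ray `a(r) = diag(z(r), 1, z(r)⁻¹)`, `r ≥ t > 0` (★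
`K2E1ReductionTheoryU3.exists_siegel_cover_three`; ★ `K2E1BorelLatticeCount.subset_borelAdelic_of_image_subset` for `Ω ⊆ B(𝔸)`), under the Iwasawa decomposition `hIw`.
* §1 THE GEOMETRY OF `𝔖`: `borelHeight_mul_of_mem_borelAdelic` (`H(ω g) = H(ω)H(g)`, ★ `borelHeight_borel_mul`, ★ `borelHeight_one`); `exists_borelHeight_bounds_of_isCompact` (`H ∈ [h₀, h₁]`,
  `h₀ > 0`, on a compact); `exists_borelHeight_mul_ray_bounds` (`h₀ r^{[E:ℚ]} ≤ H(ω a) ≤ h₁ r^{[E:ℚ]}`, ★ `borelHeight_ray`); **`exists_floor_and_smear_siegel`** (the FLOOR `H ≥ c_𝔖 > 0` on `𝔖`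
  and the smear `H(ωa) ≍ H(ωak)` of `K`, ★ `exists_smear_borelHeight`); **`exists_isCompact_low_siegel`** (the LOW PART `{g ∈ 𝔖 | H(g) ≤ H₁}` lies in a compact set: `r` is then
  bounded, and a compact `r`-interval of the ray has matrices in a compact box ★ `Mahler.exists_isCompact_posRealDiagonal_box`, pulled back along the closed embedding `val`).
* §2 **`exists_forall_ncard_le_mul_borelHeight_sq_siegel`** — MULTIPLICITY GROWTH: `∃ M₁ ≥ 0, ∀ g = ω a k ∈ 𝔖, #(G(F) ∩ (g•C)(g•C)⁻¹) ≤ M₁·H(g)²`.  HIGH PART `H(g)² > A_D`: ★ (A1)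
  `exists_smear_inter_smul_mul_inv_subset_three` puts the set inside `B(F)♯ ∩ {x | x(ωa) = (ωa)d, d ∈ D}` (`D = K(CC⁻¹)K⁻¹`), counted by ★ (A2) `exists_forall_ncard_le_mul_borelHeight_sq`:
  `≤ M·H(ωa)² ≤ M·A_K²·H(g)²`.  LOW PART: `g` lies in the compact `G₁` of §1, so the set lies in the finite `G(F) ∩ (G₁C)(G₁C)⁻¹` (★ (G0) `finite_coe_inter_of_isCompact`) and
  `1 ≤ H(g)²∕c_𝔖²`.  This is `m_g ≪ δ_B(a) = H(g)^{2ρ_H}` — with the quantitative E4 (part 1∕3 ★ `K2E1SiegelIntegralExplicit`) the two growth inputs of (A3).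
[MoeglinWaldspurger1995 I.2.4, II.1.5; Garrett2018 §1.8, §3.10–3.11; Rogawski1990 §2.2; Arthur1978 §5; Borel1963 §5.]

HONEST LABEL: HC_CM is proved only modulo the 7 printed citations (2 remaining named inputs: hLiu418 = `stmt-HodgeConjecture-24832`, h413 = `stmt-HodgeConjecture-24833`) until
rung 0 closes; count-neutral helper, closes no socket.

## References
* [MoeglinWaldspurger1995] C. Mœglin, J.-L. Waldspurger, *Spectral Decomposition and Eisenstein Series* (1995), I.2.4, I.2.13, II.1.5.
* [Garrett2018] P. Garrett, *Modern Analysis of Automorphic Forms by Example* (2018), §1.8, §2.2, §3.10–§3.11.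
* [Rogawski1990] J. D. Rogawski, *Automorphic Representations of Unitary Groups in Three Variables*, Ann. of Math. Stud. 123 (1990), §2.2 (p. 13).
* [Arthur1978TraceFormulaI] J. Arthur, *A trace formula for reductive groups I*, Duke Math. J. 45 (1978), §5.
* [Borel1963] A. Borel, *Some finiteness properties of adele groups over number fields*, Publ. Math. IHÉS 16 (1963), §5.
-/

set_option autoImplicit false
-- the mandated namespace repeats the single-problem summit's segment (`HodgeConjecture.HodgeConjecture`)
set_option linter.dupNamespace false

noncomputable section

open MeasureTheory MeasureTheory.Measure Set Filter Topology MulAction NumberField IsDedekindDomain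
open scoped ENNReal NNReal Pointwise MatrixGroups
open Literature.MeasureTheory.Group
open Literature.NumberTheory.Automorphic Literature.NumberTheory.Automorphic.UnitaryGroup
open Summit.HodgeConjecture.HodgeConjecture.Cruxes.H413.K2E1GodementCount
open Summit.HodgeConjecture.HodgeConjecture.Cruxes.H413.K2E1BorelEisensteinGodementU
open Summit.HodgeConjecture.HodgeConjecture.Cruxes.H413.K2E1RationalPointsNearBorel (exists_smear_inter_smul_mul_inv_subset_three)
open Summit.HodgeConjecture.HodgeConjecture.Cruxes.H413.K2E1BorelLatticeCount (finite_borelRational_inter_conj exists_forall_ncard_le_mul_borelHeight_sq)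
open Summit.HodgeConjecture.HodgeConjecture.Cruxes.H413.K2E1HeightFunctionU3 (borelHeight_one borelHeight_ray)
open Summit.HodgeConjecture.HodgeConjecture.Cruxes.H413.K2E1SiegelMassU3 (exists_ray_of_adelicVal_mem_siegelCone)

namespace Summit.HodgeConjecture.HodgeConjecture.Cruxes.H413.K2E1SiegelSetMultiplicityU3

variable {F E : Type} [Field F] [NumberField F] [Field E] [NumberField E] [Algebra F E] {c : E ≃ₐ[F] E} {N : ℕ}

/-! ## §1 The geometry of the Siegel set `𝔖 = Ω·A(t)·K`: heights on the Borel part, the floor, the compact low part -/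

section Geometry

/-- **`H(ω g) = H(ω)·H(g)` for `ω ∈ B(𝔸_F)`** (★ `borelHeight_borel_mul` at `g` and at `1`, `H(1) = 1` ★ `borelHeight_one`). [cite: Garrett2018, §2.2] -/
theorem borelHeight_mul_of_mem_borelAdelic [NeZero N] {ω : (quasiSplit F E c N).Adelic} (hω : ω ∈ borelAdelic F E c N) (g : (quasiSplit F E c N).Adelic) :
    borelHeight (ω * g) = borelHeight ω * borelHeight g := by
  have h1 := borelHeight_borel_mul hω 1
  rw [mul_one, borelHeight_one, mul_one] at h1
  rw [borelHeight_borel_mul hω g, h1]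

/-- **`H` is bounded above and away from `0` on a compact set** (`H` continuous ★ and positive ★). [cite: Garrett2018, §2.2] [cite: Borel1963, §5] -/
theorem exists_borelHeight_bounds_of_isCompact [NeZero N] {Ω : Set (quasiSplit F E c N).Adelic} (hΩc : IsCompact Ω) :
    ∃ h₀ h₁ : ℝ≥0, 0 < h₀ ∧ ∀ ω ∈ Ω, h₀ ≤ borelHeight ω ∧ borelHeight ω ≤ h₁ := by
  by_cases hne : Ω.Nonempty
  · obtain ⟨ω₀, hω₀, hmin⟩ := hΩc.exists_isMinOn hne continuous_borelHeight.continuousOn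
    obtain ⟨ω₁, hω₁, hmax⟩ := hΩc.exists_isMaxOn hne continuous_borelHeight.continuousOn
    exact ⟨borelHeight ω₀, borelHeight ω₁, borelHeight_pos ω₀, fun ω hω => ⟨hmin hω, hmax hω⟩⟩
  · exact ⟨1, 1, one_pos, fun ω hω => (hne ⟨ω, hω⟩).elim⟩

/-- **HEIGHTS ON THE BOREL PART OF THE SIEGEL SET**: for compact `Ω ⊆ B(𝔸_F)` there are `0 < h₀ ≤ h₁` with `h₀·r^{[E:ℚ]} ≤ H(ω·a) ≤ h₁·r^{[E:ℚ]}` for every `ω ∈ Ω` and every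
ray element `a = diag(z(r), 1, z(r)⁻¹)` (`H(ω a) = H(ω)·H(a)`, ★ `borelHeight_ray`: `H(a(r)) = r^{[E:ℚ]}`). [cite: Rogawski1990, §2.2 (p. 13)] [cite: Borel1963, §5] -/
theorem exists_borelHeight_mul_ray_bounds {Ω : Set (quasiSplit F E c 3).Adelic} (hΩc : IsCompact Ω)
    (hΩB : Ω ⊆ (borelAdelic F E c 3 : Set (quasiSplit F E c 3).Adelic)) :
    ∃ h₀ h₁ : ℝ≥0, 0 < h₀ ∧ ∀ ω ∈ Ω, ∀ (r : ℝ≥0ˣ) (a : (quasiSplit F E c 3).Adelic),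
      adelicVal F E c 3 ((StdForm.antidiagonal 3).over E) a = glDiagonal 3 (AdeleRing (𝓞 E) E) ![posRealIdele E r, 1, posRealIdele E r⁻¹] →
      h₀ * (r : ℝ≥0) ^ Module.finrank ℚ E ≤ borelHeight (ω * a) ∧ borelHeight (ω * a) ≤ h₁ * (r : ℝ≥0) ^ Module.finrank ℚ E := by
  obtain ⟨h₀, h₁, hh₀, hb⟩ := exists_borelHeight_bounds_of_isCompact hΩc
  refine ⟨h₀, h₁, hh₀, fun ω hω r a hval => ?_⟩
  rw [borelHeight_mul_of_mem_borelAdelic (hΩB hω), borelHeight_ray r hval.symm]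
  exact ⟨by gcongr; exact (hb ω hω).1, by gcongr; exact (hb ω hω).2⟩

/-- **THE HEIGHT FLOOR AND THE SMEAR ON `𝔖 = Ω·A(t)·K`.**  For compact `Ω ⊆ B(𝔸_F)`, compact `K`, `t > 0` and the Iwasawa decomposition there are `c_𝔖 > 0` and `A_K ≥ 1` with
`c_𝔖 ≤ H(ω a k)` and `H(ω a) ≤ A_K · H(ω a k)`, `H(ω a k) ≤ A_K · H(ω a)` for all `ω ∈ Ω`, `a ∈ A(t)` (`adelicVal a ∈ siegelCone 3 E t`), `k ∈ K` (smear ★ `exists_smear_borelHeight`;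
`H(ω a) ≥ h₀ t^{[E:ℚ]}`). [cite: Borel1963, §5] [cite: MoeglinWaldspurger1995, I.2.4] [cite: Garrett2018, §3.10–3.11] -/
theorem exists_floor_and_smear_siegel
    (hIw : ∀ g : (quasiSplit F E c 3).Adelic, ∃ b ∈ borelAdelic F E c 3, ∃ k : (quasiSplit F E c 3).Adelic,
      adelicVal F E c 3 ((StdForm.antidiagonal 3).over E) k ∈ standardMaximalCompactGL 3 E ∧ g = b * k)
    {Ω : Set (quasiSplit F E c 3).Adelic} (hΩc : IsCompact Ω) (hΩB : Ω ⊆ (borelAdelic F E c 3 : Set (quasiSplit F E c 3).Adelic))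
    {K : Set (quasiSplit F E c 3).Adelic} (hKc : IsCompact K) {t : ℝ} (ht : 0 < t) :
    ∃ (c𝔖 : ℝ) (AK : ℝ≥0), 0 < c𝔖 ∧ 1 ≤ AK ∧ ∀ ω ∈ Ω, ∀ a : (quasiSplit F E c 3).Adelic,
      adelicVal F E c 3 ((StdForm.antidiagonal 3).over E) a ∈ siegelCone 3 E t → ∀ k ∈ K,
        c𝔖 ≤ (borelHeight (ω * a * k) : ℝ) ∧ borelHeight (ω * a) ≤ AK * borelHeight (ω * a * k) ∧ borelHeight (ω * a * k) ≤ AK * borelHeight (ω * a) := by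
  obtain ⟨h₀, h₁, hh₀, hb⟩ := exists_borelHeight_mul_ray_bounds hΩc hΩB
  obtain ⟨AK, hAK1, hAK⟩ := exists_smear_borelHeight hIw hKc
  have hAK0 : (0 : ℝ) < AK := by exact_mod_cast lt_of_lt_of_le one_pos hAK1
  refine ⟨(h₀ : ℝ) * t ^ Module.finrank ℚ E / AK, AK, div_pos (mul_pos (by exact_mod_cast hh₀) (pow_pos ht _)) hAK0, hAK1,
    fun ω hω a ha k hk => ?_⟩
  obtain ⟨r, htr, -, hval⟩ := exists_ray_of_adelicVal_mem_siegelCone ha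
  have hlow := (hb ω hω r a hval).1
  have hsm := hAK (ω * a) k hk
  refine ⟨?_, hsm.2, hsm.1⟩
  rw [div_le_iff₀ hAK0]
  have h1 : (h₀ : ℝ) * t ^ Module.finrank ℚ E ≤ (h₀ : ℝ) * ((r : ℝ≥0) : ℝ) ^ Module.finrank ℚ E :=
    mul_le_mul_of_nonneg_left (pow_le_pow_left₀ ht.le htr _) h₀.coe_nonneg
  have h2 : (h₀ : ℝ) * ((r : ℝ≥0) : ℝ) ^ Module.finrank ℚ E ≤ (borelHeight (ω * a) : ℝ) := by exact_mod_cast hlow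
  have h3 : (borelHeight (ω * a) : ℝ) ≤ (AK : ℝ) * (borelHeight (ω * a * k) : ℝ) := by exact_mod_cast hsm.2
  linarith [mul_comm (AK : ℝ) (borelHeight (ω * a * k) : ℝ)]

/-- **THE LOW PART OF THE SIEGEL SET IS RELATIVELY COMPACT**: for every bound `H₁` there is a compact `G₁ ⊆ G(𝔸_F)` containing every `ω a k ∈ Ω·A(t)·K` with `H(ω a k) ≤ H₁`
(then `h₀ r^{[E:ℚ]} ≤ H(ω a) ≤ A_K H₁`, so `r` is bounded, and the ray over a compact `r`-interval has matrices in a compact box ★ `Mahler.exists_isCompact_posRealDiagonal_box`,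
pulled back along the closed embedding `val`). [cite: Borel1963, §5] [cite: MoeglinWaldspurger1995, I.2.13] -/
theorem exists_isCompact_low_siegel
    (hIw : ∀ g : (quasiSplit F E c 3).Adelic, ∃ b ∈ borelAdelic F E c 3, ∃ k : (quasiSplit F E c 3).Adelic,
      adelicVal F E c 3 ((StdForm.antidiagonal 3).over E) k ∈ standardMaximalCompactGL 3 E ∧ g = b * k)
    {Ω : Set (quasiSplit F E c 3).Adelic} (hΩc : IsCompact Ω) (hΩB : Ω ⊆ (borelAdelic F E c 3 : Set (quasiSplit F E c 3).Adelic))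
    {K : Set (quasiSplit F E c 3).Adelic} (hKc : IsCompact K) {t : ℝ} (ht : 0 < t) (H₁ : ℝ) :
    ∃ G₁ : Set (quasiSplit F E c 3).Adelic, IsCompact G₁ ∧ ∀ ω ∈ Ω, ∀ a : (quasiSplit F E c 3).Adelic,
      adelicVal F E c 3 ((StdForm.antidiagonal 3).over E) a ∈ siegelCone 3 E t → ∀ k ∈ K,
        (borelHeight (ω * a * k) : ℝ) ≤ H₁ → ω * a * k ∈ G₁ := by
  obtain ⟨h₀, h₁, hh₀, hb⟩ := exists_borelHeight_mul_ray_bounds hΩc hΩB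
  obtain ⟨AK, hAK1, hAK⟩ := exists_smear_borelHeight hIw hKc
  have hh₀' : (0 : ℝ) < h₀ := by exact_mod_cast hh₀
  -- the bound on `r`: `r ≤ r₁ := max 1 (A_K H₁ ∕ h₀)`
  set R₁ : ℝ := (AK : ℝ) * H₁ / h₀ with hR₁
  set r₁ : ℝ≥0 := max 1 R₁.toNNReal with hr₁
  have hr₁1 : 1 ≤ r₁ := le_max_left _ _
  have hr₁0 : r₁ ≠ 0 := (lt_of_lt_of_le one_pos hr₁1).ne'
  set tN : ℝ≥0 := t.toNNReal with htN
  have htN0 : tN ≠ 0 := by rw [htN]; exact (Real.toNNReal_pos.2 ht).ne'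
  -- the compact box of matrices and its preimage
  obtain ⟨Z, hZc, hZ⟩ := Mahler.exists_isCompact_posRealDiagonal_box 3 E (min tN r₁⁻¹) (max r₁ tN⁻¹) (by positivity)
  have hemb : Topology.IsClosedEmbedding (adelicVal F E c 3 ((StdForm.antidiagonal 3).over E)) :=
    (isClosed_adelic F E c 3 ((StdForm.antidiagonal 3).over E)).isClosedEmbedding_subtypeVal
  refine ⟨Ω * (adelicVal F E c 3 ((StdForm.antidiagonal 3).over E) ⁻¹' Z) * K, (hΩc.mul (hemb.isCompact_preimage hZc)).mul hKc,
    fun ω hω a ha k hk hH => Set.mul_mem_mul (Set.mul_mem_mul hω ?_) hk⟩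
  obtain ⟨r, htr, hpos, hval⟩ := exists_ray_of_adelicVal_mem_siegelCone ha
  -- `r^{[E:ℚ]} ≤ R₁`, hence `r ≤ r₁`
  have hr0 : (0 : ℝ) < (r : ℝ≥0) := ht.trans_le htr
  have hrn : ((r : ℝ≥0) : ℝ) ^ Module.finrank ℚ E ≤ R₁ := by
    have h1 : (h₀ : ℝ) * ((r : ℝ≥0) : ℝ) ^ Module.finrank ℚ E ≤ (borelHeight (ω * a) : ℝ) := by exact_mod_cast (hb ω hω r a hval).1
    have h2 : (borelHeight (ω * a) : ℝ) ≤ (AK : ℝ) * (borelHeight (ω * a * k) : ℝ) := by exact_mod_cast (hAK (ω * a) k hk).2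
    rw [hR₁, le_div_iff₀ hh₀', mul_comm]
    exact h1.trans (h2.trans (mul_le_mul_of_nonneg_left hH AK.coe_nonneg))
  have hrle : (r : ℝ≥0) ≤ r₁ := by
    rw [← NNReal.coe_le_coe]
    rcases le_or_gt ((r : ℝ≥0) : ℝ) 1 with hle | hgt
    · exact hle.trans (by exact_mod_cast hr₁1)
    · have hn : 1 ≤ Module.finrank ℚ E := Module.finrank_pos
      have : ((r : ℝ≥0) : ℝ) ≤ ((r : ℝ≥0) : ℝ) ^ Module.finrank ℚ E := by
        simpa using pow_le_pow_right₀ hgt.le hn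
      have hR : ((r : ℝ≥0) : ℝ) ≤ R₁ := this.trans hrn
      calc ((r : ℝ≥0) : ℝ) ≤ (R₁.toNNReal : ℝ) := by rw [Real.coe_toNNReal _ (hr0.le.trans hR)]; exact hR
        _ ≤ (r₁ : ℝ) := by exact_mod_cast le_max_right _ _
  have htle : tN ≤ (r : ℝ≥0) := by
    rw [htN, ← NNReal.coe_le_coe, Real.coe_toNNReal _ ht.le]
    exact htr
  rw [Set.mem_preimage, hpos]
  refine hZ _ fun i => ?_
  fin_cases i
  · exact ⟨(min_le_left _ _).trans htle, hrle.trans (le_max_left _ _)⟩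
  · refine ⟨le_trans (min_le_right _ _) ?_, le_trans hr₁1 (le_max_left _ _)⟩
    change r₁⁻¹ ≤ ((1 : ℝ≥0ˣ) : ℝ≥0)
    rw [Units.val_one]
    exact inv_le_one_of_one_le₀ hr₁1
  · change min tN r₁⁻¹ ≤ ((r⁻¹ : ℝ≥0ˣ) : ℝ≥0) ∧ ((r⁻¹ : ℝ≥0ˣ) : ℝ≥0) ≤ max r₁ tN⁻¹
    rw [Units.val_inv_eq_inv_val]
    have hrpos : 0 < (r : ℝ≥0) := lt_of_lt_of_le (pos_iff_ne_zero.2 htN0) htle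
    exact ⟨(min_le_right _ _).trans (inv_anti₀ hrpos hrle), (inv_anti₀ (pos_iff_ne_zero.2 htN0) htle).trans (le_max_right _ _)⟩

end Geometry

/-! ## §2 Multiplicity growth on the Siegel set: `#(G(F) ∩ (g•C)(g•C)⁻¹) ≤ M₁ · H(g)²` -/

section Multiplicity

/-- **MULTIPLICITY GROWTH ON `𝔖 = Ω·A(t)·K`.**  For `c² = 1 ≠ c`, Iwasawa, compact `Ω ⊆ B(𝔸_F)`, compact `K`, `t > 0` and compact `C` there is `M₁ ≥ 0` with
  `#(G(F) ∩ (g•C)·(g•C)⁻¹) ≤ M₁ · H(g)²`  for every `g = ω a k ∈ 𝔖`.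
HIGH PART `H(g)² > A_D` (`A_D` the smear constant of `D = K(CC⁻¹)K⁻¹`): ★ (A1) `exists_smear_inter_smul_mul_inv_subset_three` puts the set inside `B(F)♯ ∩ {x | x(ωa) = (ωa)d, d ∈ D}`,
which ★ (A2) `exists_forall_ncard_le_mul_borelHeight_sq` counts by `M·H(ωa)² ≤ M·A_K²·H(g)²` (smear of `K`).  LOW PART: `g` lies in the compact `G₁` of §1, so the set lies in the
FINITE `G(F) ∩ (G₁C)(G₁C)⁻¹` (★ (G0) `finite_coe_inter_of_isCompact`), and `1 ≤ H(g)²∕c_𝔖²` (floor). [cite: MoeglinWaldspurger1995, I.2.4 and II.1.5] [cite: Garrett2018, §1.8 and §3.10]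
[cite: Rogawski1990, §2.2 (p. 13)] [cite: Arthur1978TraceFormulaI, §5] -/
theorem exists_forall_ncard_le_mul_borelHeight_sq_siegel (hc : c * c = 1) (hc1 : c ≠ 1)
    (hIw : ∀ g : (quasiSplit F E c 3).Adelic, ∃ b ∈ borelAdelic F E c 3, ∃ k : (quasiSplit F E c 3).Adelic,
      adelicVal F E c 3 ((StdForm.antidiagonal 3).over E) k ∈ standardMaximalCompactGL 3 E ∧ g = b * k)
    {Ω : Set (quasiSplit F E c 3).Adelic} (hΩc : IsCompact Ω) (hΩB : Ω ⊆ (borelAdelic F E c 3 : Set (quasiSplit F E c 3).Adelic))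
    {K : Set (quasiSplit F E c 3).Adelic} (hKc : IsCompact K) {t : ℝ} (ht : 0 < t) {C : Set (quasiSplit F E c 3).Adelic} (hCc : IsCompact C) :
    ∃ M₁ : ℝ, 0 ≤ M₁ ∧ ∀ ω ∈ Ω, ∀ a : (quasiSplit F E c 3).Adelic, adelicVal F E c 3 ((StdForm.antidiagonal 3).over E) a ∈ siegelCone 3 E t → ∀ k ∈ K,
      ((((quasiSplit F E c 3).arithmeticSubgroup : Set (quasiSplit F E c 3).Adelic) ∩ (((ω * a * k) • C) * ((ω * a * k) • C)⁻¹)).ncard : ℝ) ≤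
        M₁ * ((borelHeight (ω * a * k) : ℝ) * (borelHeight (ω * a * k) : ℝ)) := by
  classical
  haveI : T2Space (quasiSplit F E c 3).Adelic := inferInstanceAs (T2Space (adelic F E c 3 ((StdForm.antidiagonal 3).over E)))
  haveI : DiscreteTopology (quasiSplit F E c 3).arithmeticSubgroup := isDiscreteRational_quasiSplit
  -- (A1) with its smear constant `A_D`, (A2) with `D = K(CC⁻¹)K⁻¹`, the smear of `K`, the floor, the compact low part
  obtain ⟨AD, -, hincl⟩ := exists_smear_inter_smul_mul_inv_subset_three hIw hCc K
  have hDc : IsCompact (K * (C * C⁻¹) * K⁻¹) := (hKc.mul (hCc.mul hCc.inv)).mul hKc.inv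
  obtain ⟨M, hM⟩ := exists_forall_ncard_le_mul_borelHeight_sq hc hc1 hΩc hΩB ht hDc
  obtain ⟨c𝔖, AK, hc𝔖, -, hfl⟩ := exists_floor_and_smear_siegel hIw hΩc hΩB hKc ht
  obtain ⟨G₁, hG₁c, hG₁⟩ := exists_isCompact_low_siegel hIw hΩc hΩB hKc ht (max 1 (AD : ℝ))
  have hlowfin : (((quasiSplit F E c 3).arithmeticSubgroup : Set (quasiSplit F E c 3).Adelic) ∩ ((G₁ * C) * (G₁ * C)⁻¹)).Finite :=
    finite_coe_inter_of_isCompact (quasiSplit F E c 3).arithmeticSubgroup ((hG₁c.mul hCc).mul (hG₁c.mul hCc).inv)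
  set mlow : ℕ := (((quasiSplit F E c 3).arithmeticSubgroup : Set (quasiSplit F E c 3).Adelic) ∩ ((G₁ * C) * (G₁ * C)⁻¹)).ncard with hmlow
  refine ⟨max ((M : ℝ) * (AK : ℝ) ^ 2) ((mlow : ℝ) / c𝔖 ^ 2), le_max_of_le_left (by positivity), fun ω hω a ha k hk => ?_⟩
  obtain ⟨hflo, hsm1, -⟩ := hfl ω hω a ha k hk
  -- the set to count, in `ℝ`
  set S : Set (quasiSplit F E c 3).Adelic :=
    ((quasiSplit F E c 3).arithmeticSubgroup : Set (quasiSplit F E c 3).Adelic) ∩ (((ω * a * k) • C) * ((ω * a * k) • C)⁻¹) with hS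
  have hH0 : (0 : ℝ) ≤ (borelHeight (ω * a * k) : ℝ) := NNReal.coe_nonneg _
  by_cases hhigh : AD < borelHeight (ω * a * k) * borelHeight (ω * a * k)
  · -- HIGH PART: (A1) + (A2) + smear
    obtain ⟨r, -, -, hval⟩ := exists_ray_of_adelicVal_mem_siegelCone ha
    have hb : ω * a ∈ borelAdelic F E c 3 := Subgroup.mul_mem _ (hΩB hω) (torusAdelic_le_borelAdelic ⟨_, hval.symm⟩)
    set T : Set (quasiSplit F E c 3).Adelic :=
      ((arithmeticBorel F E c 3).map (quasiSplit F E c 3).arithmeticSubgroup.subtype : Set (quasiSplit F E c 3).Adelic) ∩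
        {x | ∃ d ∈ K * (C * C⁻¹) * K⁻¹, x * (ω * a) = (ω * a) * d} with hT
    have hsub : S ⊆ T := hincl (ω * a * k) ⟨ω * a, hb⟩ k hk rfl hhigh
    have hTfin : T.Finite := finite_borelRational_inter_conj (N := 3) hDc (ω * a)
    have h1 : (S.ncard : ℝ) ≤ (T.ncard : ℝ) := Nat.cast_le.2 (Set.ncard_le_ncard hsub hTfin)
    have h2 : (T.ncard : ℝ) ≤ (M : ℝ) * ((borelHeight (ω * a) : ℝ) * (borelHeight (ω * a) : ℝ)) := by
      have h := NNReal.coe_le_coe.2 (hM ω hω a ha)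
      rw [NNReal.coe_natCast, NNReal.coe_mul, NNReal.coe_mul] at h
      exact h
    have h3 : (borelHeight (ω * a) : ℝ) ≤ (AK : ℝ) * (borelHeight (ω * a * k) : ℝ) := by
      have h := NNReal.coe_le_coe.2 hsm1
      rw [NNReal.coe_mul] at h
      exact h
    have h4 : (borelHeight (ω * a) : ℝ) * (borelHeight (ω * a) : ℝ) ≤
        ((AK : ℝ) * (borelHeight (ω * a * k) : ℝ)) * ((AK : ℝ) * (borelHeight (ω * a * k) : ℝ)) :=
      mul_le_mul h3 h3 (NNReal.coe_nonneg _) (mul_nonneg AK.coe_nonneg hH0)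
    calc (S.ncard : ℝ) ≤ (T.ncard : ℝ) := h1
      _ ≤ (M : ℝ) * ((borelHeight (ω * a) : ℝ) * (borelHeight (ω * a) : ℝ)) := h2
      _ ≤ (M : ℝ) * (((AK : ℝ) * (borelHeight (ω * a * k) : ℝ)) * ((AK : ℝ) * (borelHeight (ω * a * k) : ℝ))) :=
          mul_le_mul_of_nonneg_left h4 M.coe_nonneg
      _ = (M : ℝ) * (AK : ℝ) ^ 2 * ((borelHeight (ω * a * k) : ℝ) * (borelHeight (ω * a * k) : ℝ)) := by ring
      _ ≤ max ((M : ℝ) * (AK : ℝ) ^ 2) ((mlow : ℝ) / c𝔖 ^ 2) * ((borelHeight (ω * a * k) : ℝ) * (borelHeight (ω * a * k) : ℝ)) :=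
          mul_le_mul_of_nonneg_right (le_max_left _ _) (mul_nonneg hH0 hH0)
  · -- LOW PART: `H(g) ≤ max 1 A_D`, `g ∈ G₁`, uniform multiplicity and the floor
    have hHle : (borelHeight (ω * a * k) : ℝ) ≤ max 1 (AD : ℝ) := by
      rw [not_lt] at hhigh
      rcases le_or_gt (borelHeight (ω * a * k)) 1 with hle | hgt
      · exact le_max_of_le_left (by exact_mod_cast hle)
      · have h' : borelHeight (ω * a * k) ≤ borelHeight (ω * a * k) * borelHeight (ω * a * k) := le_mul_of_one_le_left' hgt.le
        exact le_max_of_le_right (by exact_mod_cast h'.trans hhigh)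
    have hgG₁ : ω * a * k ∈ G₁ := hG₁ ω hω a ha k hk hHle
    have hsub : S ⊆ ((quasiSplit F E c 3).arithmeticSubgroup : Set (quasiSplit F E c 3).Adelic) ∩ ((G₁ * C) * (G₁ * C)⁻¹) :=
      Set.inter_subset_inter_right _ (Set.mul_subset_mul (Set.smul_set_subset_mul hgG₁) (Set.inv_subset_inv.2 (Set.smul_set_subset_mul hgG₁)))
    have h1 : (S.ncard : ℝ) ≤ (mlow : ℝ) := Nat.cast_le.2 (Set.ncard_le_ncard hsub hlowfin)
    have hHg : c𝔖 ≤ (borelHeight (ω * a * k) : ℝ) := hflo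
    have hc2 : (0 : ℝ) < c𝔖 ^ 2 := by positivity
    calc (S.ncard : ℝ) ≤ (mlow : ℝ) := h1
      _ = (mlow : ℝ) / c𝔖 ^ 2 * (c𝔖 * c𝔖) := by field_simp
      _ ≤ (mlow : ℝ) / c𝔖 ^ 2 * ((borelHeight (ω * a * k) : ℝ) * (borelHeight (ω * a * k) : ℝ)) :=
          mul_le_mul_of_nonneg_left (mul_le_mul hHg hHg hc𝔖.le hH0) (div_nonneg (Nat.cast_nonneg _) hc2.le)
      _ ≤ max ((M : ℝ) * (AK : ℝ) ^ 2) ((mlow : ℝ) / c𝔖 ^ 2) * ((borelHeight (ω * a * k) : ℝ) * (borelHeight (ω * a * k) : ℝ)) :=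
          mul_le_mul_of_nonneg_right (le_max_right _ _) (mul_nonneg hH0 hH0)

end Multiplicity

end Summit.HodgeConjecture.HodgeConjecture.Cruxes.H413.K2E1SiegelSetMultiplicityU3

end
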